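/-
Copyright: public-audit package `pub-balaban` (b2b-balaban), seat pv09-g6. Released under Apache 2.0 like Mathlib.
-/
import Mathlib
import Literature.MathematicalPhysics.QuantumFieldTheory.Balaban1983to89.B6Cov2156Torus

/-!
# B6 (2.152)–(2.157) on a subset Λ ⊂ T^(k), END-TO-END for the concrete (1.66) form: the Λ-integral is the
sub-family of Λ-bonds of the whole-torus scheme — same elimination matrix, same constants

Source under audit: T. Bałaban, *Propagators and renormalization transformations for lattice gauge theories. II*,
Commun. Math. Phys. **96** (1984) 223–250 [B6], (2.152)–(2.157) pp. 249–250 and Lemma 2.4 p. 245; with *… I*,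
Commun. Math. Phys. **95** (1984) 17–40 [B5], (1.66) p. 29.  Quotations read by this seat from the ×2 page renders
`run/shared/lean/pub/pub-balaban/b2b-balaban-ref1/pages/1984-cmp96-propagators-rt-II/…-p023-x2.png` (p. 245),
`…-p027-x2.png` (p. 249) and `…-p028-x2.png` (p. 250) (journal page = PDF page + 222), not from an OCR layer.

CITATION HEADER (lean-in-tree rule).  Cell `pub-balaban`, unit `b2b-balaban-pv09-g6` (surge node prover #09, gen 6;
journal claim G-B6-2156-TORUS-SUBSET, self-assigned under the yield clause).  Sibling imported, not edited:
`…B6Cov2156Torus` (this unit, same gen: the torus multiplicities `multP`, the remaining variables `freeT`, THE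
elimination matrix C of p. 250 on the torus `elimT` with `q1_elimT_mulVec` / `elimT_mulVec_tree` / `elimT_restrT` /
`elimT_iso` / `elimT_range` / `elimT_col` / `elimT_row`, (2.153) on the torus `lowerOnConstrainedT_of_represents`,
`Represents`, `deltaPol`, `KernelDecay`); through it `…B6LowerBound2153Torus` §7 (this lineage, gen 5: the
Λ-dictionary on the torus `InLam` / `facesOf` / `not_inLam_segment` / `q1_eq_zero_of_not_meeting` /
`treeGauge_of_not_inLam`), `…B6BondEliminationTorus` (gen 4: `pdist`, `PrintedPer`, Sect. 5 of [3] on tori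
`subReductions_per`, PROVED), `…B6BondElimination` (unit b06-g3: `SubReduction`, `.cov` = (2.156), `pivSite`/`cOf`,
`hits`/`mult`, `IsTree`, `freeB`), `…B6Lemma24Torus` (gen 5: `pbox`, `wrap`, `coarseSites`, `faces`),
`…B6Lemma24PrintedShape` (b06-g6: (Q₁B)(c) verbatim, `q1`).

## What is printed (verbatim)

* [B6] p. 245, Lemma 2.4: *"Let a set Λ ⊂ Z^d be a sum of blocks, Λ = B(Λ′). We denote by Λ also a set of bonds b
  such that at least one of the end-points b₋, b₊ belongs to Λ. Let B be a configuration defined on Λ and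
  satisfying the condition (2.121): B(Γ_{y,x}) = 0 for x ∈ B(y), y ∈ Λ′. We put B = 0 outside Λ. Then the
  following inequality holds  L^{d−2} Σ_{c∈Λ′} |(Q₁B)(c)|² + Σ_p |(∂₁B)(p)|² ≥ (1/12d²) L^{−d−1}‖B‖².  (2.128)"*
* [B6] p. 249: *"Doing a k + 1 renormalization transformation we have to calculate an integral of the form
  const ∫dB δ(QB) δ_{Ax}(B) e^{−½⟨B,Δ_kB⟩} F(B)  (1.152) [sic: (2.152)]  on the whole lattice T^{(k)}, or on a subset
  Λ ⊂ T^{(k)}. … Let us denote the covariance of the Gaussian integration in (2.152) by C^{(k)}, or by C^{(k)}_Λ,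
  hence  ∫dB↾_Λ δ(QB) δ_{Ax}(B) e^{−½⟨B,Δ_kB⟩+⟨J,B⟩} = Z^{(k)} e^{½⟨J,C^{(k)}_Λ J⟩}.  (2.154)  An easy way to get a
  useful representation for C^{(k)}_Λ is to get rid of the unnecessary variables in the integral above. We remove
  the variables B_b for b ⊂ Γ_{y,x} using the δ-functions δ_{Ax}(B). Next we remove the variables B_{b₀}, where b₀
  is a bond belonging to B(c) for some c ∈ Λ′, and contained in c, using the δ-functions δ((QB)(c)). If we denote
  the remaining variables by B′, then we can write B = CB′, where C is a linear"* [p. 250:] *"operator, and we have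
  … hence  C^{(k)}_Λ = C(C*Δ_kC)^{−1}C*.  (2.156)  By the definition of C we have of course that CB′ = 0 outside Λ,
  QCB′ = 0, (CB′)(Γ_{y,x}) = 0, x ∈ B(y), y ∈ Λ′, for arbitrary B′. The inequality (2.153) implies
  ⟨B′, C*Δ_kCB′⟩ ≥ (γ₀/12d²)L^{−d−1}‖CB′‖² ≥ γ′₀‖B′‖²,  (2.157) … C is a short-ranged operator, so C*Δ_kC has the
  same exponential decay as Δ_k. Now we may apply the theory developed in Sect. 5 of [3] on unit lattice
  operators. It gives us an exponential decay, and all the other properties, for the operator (C*Δ_kC)^{−1}, hence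
  for C^{(k)}_Λ also."*

READING OF Λ′ (one clause, answering the records-only remark R1 of the hostile cross-read of `…B6Cov2156Torus` v1,
GAPS C-A40-1): pp. 245/249/250 use Λ′ both for the coarse SITES y (*"Λ = B(Λ′)"*, *"y ∈ Λ′"*) and for the coarse
BONDS c (*"c ∈ Λ′"* in (2.128) and on p. 249; (L^d)^{|Λ′|} in (2.155)).  This file keeps them apart, as gen 5 did:
`Λ'₀` = a set of coarse sites of the torus (Λ = B(Λ′₀) = ⋃_{y∈Λ′₀} B(y), membership mod M = `InLam`), and
`B6LowerBound2153Torus.facesOf L M Λ'₀` = the coarse bonds of T with at least one end-point in Λ′₀ = the *"c ∈ Λ′"*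
of the constraints δ((QB)(c)) (Lemma 2.4's bond convention one scale up; the cell's reading C-pv09g5-2 §7).

## The point of this file

`…B6Cov2156Torus` treats (2.152) *"on the whole lattice T^{(k)}"*.  For the case *"or on a subset Λ ⊂ T^{(k)}"* —
Λ = B(Λ′₀), the variables B↾Λ of (2.154) = the torus bonds with at least one end-point in Λ (Lemma 2.4's
convention), B = 0 outside Λ, constraints δ((QB)(c)) for the coarse bonds c meeting Λ′₀ and δ(B(Γ_{y,x})) for
y ∈ Λ′₀, exponent ½⟨B, Δ_kB⟩ with the same torus form — NO NEW ELIMINATION IS NEEDED: the remaining variables B′ of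
the Λ-integral are exactly the Λ-bonds among the remaining variables of the torus (`lamFree`, `mem_lamFree_iff`), and
the elimination matrix of the Λ-integral is the COLUMN RESTRICTION of the torus matrix C to them (`elimLam`): its
other columns are never used and its rows outside Λ vanish on these columns (`elimT_eq_zero_of_not_isLam` — a torus
average (Q₁B)(c) of a coarse bond c not meeting Λ′₀ involves no Λ-bond, `multP_eq_zero_of_not_meeting`, by gen 5's
`not_inLam_segment`).  And for EVERY sub-family S of the remaining torus variables the column restriction C_S keeps
the printed-shape inputs of p. 250 with the SAME constants (§1): C_S B′ = C(B′ extended by 0), so *"QCB′ = 0"* holds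
at every face and *"(CB′)(Γ_{y,x}) = 0"* on every block, whence the WHOLE-torus (2.153) (proved upstream) is the
first inequality of (2.157) for it; ‖C_S B′‖ ≥ ‖B′‖, range, row and column sums are inherited.  Sect. 5 of [3] on
tori (`subReductions_per`, proved) then gives ONE (c, δ) for all tori, all n and all S — in particular for all Λ.

## What this file proves (kernel-checked, no `sorry`; axioms ⊆ {propext, Classical.choice, Quot.sound})

* §1 (sub-families, [folklore] bookkeeping): `elimTS L M S hS` (columns S ⊆ `freeT` of `elimT`), `extS`
  (extension by zero), `elimTS_mulVec` (C_S B′ = C(ext B′)), `elimTS_mulVec_mem`, `elimTS_iso`, `elimTS_mulVec_tree`,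
  `q1_elimTS_mulVec`, `elimTS_row`; `subFamilyT L M S hS Δ : SubReduction d d` (Ω = box, kept = S, C = C_S), its
  printed-shape inputs `subFamilyT_printedPer` (range L − 1, ℓ¹ ≤ L^d + 1, lower bound = (2.153)_T), and
  `bond250_torusS` / `cov2156_torusS`: ONE (c, δ) for all tori (L ∣ M_i), all symmetric Δ with ρ_M-decay and
  (2.153)_T [resp. all n ≥ 1 and all symmetric Δ representing the (1.66) form with ρ_M-decay], and ALL S.
* §2 (Λ = B(Λ′₀) ⊂ T, [cite] dictionary): `IsLam L M Λ'₀ b` (b₋ or b₊ in Λ mod M), `lamFree` = `freeT` ∩ Λ-bonds,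
  `elimLam` = C_{lamFree}, `bondReductionLam L M Λ'₀ Δ`; PROVED: `multP_eq_zero_of_not_meeting`,
  `isLam_iff_of_cOf_mem` (a pivot b₀(c) is a Λ-bond iff c meets Λ′₀), **`elimT_eq_zero_of_not_isLam`** and
  **`elimLam_mulVec_eq_zero`** (*"CB′ = 0 outside Λ"*), **`mem_lamFree_iff`** (the remaining variables of the
  Λ-integral: Λ-bonds other than the pivots b₀(c), c meeting Λ′₀, and the tree bonds of the blocks of Λ′₀),
  `q1_elimLam_mulVec` / `elimLam_mulVec_tree` (*"QCB′ = 0, (CB′)(Γ_{y,x}) = 0"*, at every face / block, a fortiori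
  at those of Λ), **`elimLam_restr`** (C_Λ is ONTO {B : B = 0 outside Λ, (Q₁B)(c) = 0 for c meeting Λ′₀,
  B(Γ_{y,x}) = 0 for y ∈ Λ′₀} with the coordinate projection as inverse — the change of variables (2.154) = (2.155)
  for Λ), **`sandwich_eq_of_agree`** / **`cov_eq_of_agree`** (C*Δ_kC and C^{(k)}_Λ see only the entries Δ_k(b, b′),
  b, b′ ∈ Λ: the Λ-integral's exponent is the torus form of B with B = 0 outside Λ), `lamFree_univ` (Λ′₀ ⊇ T′ gives
  back the whole-torus scheme).
* §3 END-TO-END: **`cov2156_torus_subset`** — d ≥ 2, L ≥ 1, c₀, δ₀ > 0 ⟹ ∃ c, δ > 0 ∀ tori M (L ∣ M_i) ∀ n ≥ 1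
  ∀ symmetric Δ representing the (1.66) form at level n with |Δ(b,b′)| ≤ c₀e^{−δ₀ρ_M(b₋,b′₋)} ∀ Λ′₀:
  |C^{(k)}_Λ(b,b′)| ≤ c·e^{−δρ_M(b₋,b′₋)} for C^{(k)}_Λ = C_Λ(C_Λ*Δ_kC_Λ)⁻¹C_Λ* of (2.156); and
  **`cov2156_torus_subset_deltaPol`** — the same for THE matrix `deltaPol M n` of the (1.66) form with
  `KernelDecay M n c₀ δ₀` the ONLY hypothesis besides d ≥ 2, L ≥ 1, L ∣ M_i, n ≥ 1.  The constants are those of the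
  whole-torus theorem (`B6BondEliminationTorus.subReductions_per` at (γ, c₀, δ₀, L − 1, L^d + 1)).

## HONEST SCOPE (what is NOT claimed)

(i) As upstream, THE DECAY OF Δ_k IS A HYPOTHESIS (`KernelDecay` / `hdec`); p. 250 presupposes it.  (ii) The
Λ-integral (2.152)/(2.154) is READ as in C-pv09g5-2 §7 / Lemma 2.4: variables = torus bonds with ≥ 1 end-point in
Λ = B(Λ′₀), B = 0 outside Λ, exponent = the torus (1.66) form of that B (so only the entries Δ_k(b,b′), b, b′ ∈ Λ
enter, `cov_eq_of_agree`), constraints at the coarse bonds meeting Λ′₀ and the blocks of Λ′₀; a differently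
defined restricted operator Δ_{k,Λ} is NOT addressed; (1.65) = (1.66) is not certified (package-wide).  (iii) In
`bondReductionLam` the variables outside Λ are carried as identically-zero coordinates (C_Λ has zero rows there,
`elimLam_mulVec_eq_zero`), so `.cov` is the matrix C^{(k)}_Λ padded with zero rows and columns outside Λ — the decay
statement is about all entries, in particular the Λ × Λ ones.  (iv) Only the exponential decay of C^{(k)}_Λ is
transported (*"all the other properties"*, (L^d)^{|Λ′|}, Z′^{(k)} not formalised).  (v) d ≥ 2, L ≥ 1, all M_i ≥ 1
with L ∣ M_i; Λ′₀ any finite set of points of Z^d (only its coarse sites of the box matter); "QB = 0" = Q₁ of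
(2.125), "B(Γ_{y,x}) = 0" = `IsTree`.  (vi) Value = kernel certificate of the printed bookkeeping; NOT summit
progress.

DIVERGENCES: none new (label "(1.152)" sic = D-b06.9).
-/

open Finset Matrix

namespace Literature.MathematicalPhysics.QuantumFieldTheory.Balaban1983to89.B6Cov2156TorusSubset

open B6Elimination (corner corner_apply mem_block mem_block_corner corner_eq_of_mem_block corner_eq_self_of_dvd)
open B6BondElimination (unitVec unitVec_apply pivSite cOf pivSite_cOf cOf_snd hits mem_hits mult IsTree freeB
  mem_freeB SubReduction)
open B6TreeGaugePoincare (Cfg)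
open B6Lemma24PrintedShape (q1)
open B6Lemma24Torus (pbox mem_pbox coarseSites mem_coarseSites coarseSites_dvd faces mem_faces wrap wrap_mem_pbox
  wrap_eq_self wrap_wrap_add block_subset_pbox corner_mem_coarseSites)
open B6BondEliminationTorus (pdist PrintedPer subReductions_per box_separated)
open B6LowerBound2153Torus (pos_of_neZero InLam facesOf mem_facesOf inLam_iff_of_mem_block not_inLam_segment
  q1_eq_zero_of_not_meeting inLam_iff_mem)
open B6Cov2156Torus (multP exists_of_multP_ne_zero pivSite_mem_block freeT elimT elimT_apply elimT_mulVec_free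
  elimT_mulVec_tree q1_elimT_mulVec restrT elimT_restrT elimT_range elimT_col elimT_row one_le_M perExt
  LowerOnConstrainedT Represents gamma2153 gamma2153_pos lowerOnConstrainedT_of_represents deltaPol deltaPol_isSymm
  represents_deltaPol KernelDecay)

noncomputable section

variable {d : ℕ} {L : ℕ} {M : Fin d → ℕ}

/-! ## §1  Sub-families of the remaining variables: the column restriction of C keeps the printed-shape inputs -/

section SubFamily

variable (L) (M)

/-- The COLUMN RESTRICTION C_S of the torus elimination matrix C (`B6Cov2156Torus.elimT`) to a sub-family S of the
remaining variables. [folklore] -/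
def elimTS (S : Finset (B4.Idx (pbox M) d)) (hS : S ⊆ freeT L M) : Matrix (B4.Idx (pbox M) d) S ℝ :=
  fun p k => elimT L M p ⟨(k : B4.Idx (pbox M) d), hS k.2⟩

/-- Extension by zero of B′ ∈ ℝ^S to the remaining variables of the torus. [folklore] -/
def extS (S : Finset (B4.Idx (pbox M) d)) (w : S → ℝ) : freeT L M → ℝ :=
  fun f => ∑ k : S, if (k : B4.Idx (pbox M) d) = (f : B4.Idx (pbox M) d) then w k else 0

variable {L M}
variable {S : Finset (B4.Idx (pbox M) d)} (hS : S ⊆ freeT L M)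

/-- The extension by zero agrees with B′ on S. [folklore] -/
theorem extS_apply_mem (w : S → ℝ) (k : S) : extS L M S w ⟨(k : B4.Idx (pbox M) d), hS k.2⟩ = w k := by
  unfold extS
  rw [Finset.sum_eq_single k]
  · simp
  · intro k' _ hk'
    rw [if_neg]
    exact fun h => hk' (Subtype.ext h)
  · intro h
    exact absurd (Finset.mem_univ k) h

/-- The extension by zero vanishes off S. [folklore] -/
theorem extS_apply_of_not_mem (w : S → ℝ) (f : freeT L M) (hf : (f : B4.Idx (pbox M) d) ∉ S) :
    extS L M S w f = 0 :=
  Finset.sum_eq_zero fun k _ => if_neg fun h => hf (by rw [← h]; exact k.2)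

/-- C_S B′ = C(B′ extended by zero). [folklore] -/
theorem elimTS_mulVec (w : S → ℝ) : elimTS L M S hS *ᵥ w = elimT L M *ᵥ extS L M S w := by
  funext p
  simp only [Matrix.mulVec, dotProduct, elimTS, extS, Finset.mul_sum]
  rw [Finset.sum_comm]
  refine Finset.sum_congr rfl fun k _ => ?_
  rw [Finset.sum_eq_single ⟨(k : B4.Idx (pbox M) d), hS k.2⟩]
  · simp
  · intro f _ hf
    rw [if_neg, mul_zero]
    intro h
    exact hf (Subtype.ext h.symm)
  · intro h
    exact absurd (Finset.mem_univ _) h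

/-- (C_S B′)(b′) = B′(b′) on S. [folklore] -/
theorem elimTS_mulVec_mem (w : S → ℝ) (k : S) : (elimTS L M S hS *ᵥ w) (k : B4.Idx (pbox M) d) = w k := by
  rw [elimTS_mulVec]
  have h := elimT_mulVec_free (extS L M S w) ⟨(k : B4.Idx (pbox M) d), hS k.2⟩
  rw [extS_apply_mem hS] at h
  exact h

/-- ‖C_S B′‖ ≥ ‖B′‖ (second inequality of (2.157) for the sub-family). [folklore] -/
theorem elimTS_iso (w : S → ℝ) : ∑ k, w k ^ 2 ≤ ∑ p, (elimTS L M S hS *ᵥ w) p ^ 2 := by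
  calc ∑ k, w k ^ 2 = ∑ k : S, (elimTS L M S hS *ᵥ w) (k : B4.Idx (pbox M) d) ^ 2 :=
        Finset.sum_congr rfl fun k _ => by rw [elimTS_mulVec_mem]
    _ = ∑ p ∈ S, (elimTS L M S hS *ᵥ w) p ^ 2 :=
        Finset.sum_coe_sort S (fun p => (elimTS L M S hS *ᵥ w) p ^ 2)
    _ ≤ ∑ p, (elimTS L M S hS *ᵥ w) p ^ 2 :=
        Finset.sum_le_univ_sum_of_nonneg fun p => sq_nonneg _

/-- C_S B′ vanishes on every tree bond of every block of the torus. [folklore] -/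
theorem elimTS_mulVec_tree (w : S → ℝ) {p : B4.Idx (pbox M) d} (hp : IsTree L (coarseSites L M) p) :
    (elimTS L M S hS *ᵥ w) p = 0 := by
  rw [elimTS_mulVec]
  exact elimT_mulVec_tree _ hp

/-- (Q₁(C_S B′)^per)(c) = 0 at every face of the torus. [folklore] -/
theorem q1_elimTS_mulVec [∀ μ, NeZero (M μ)] (hL : 0 < L) (hLM : ∀ i, L ∣ M i) (w : S → ℝ)
    {c : (Fin d → ℤ) × Fin d} (hc : c ∈ faces L M) : q1 L (perExt M (elimTS L M S hS *ᵥ w)) c = 0 := by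
  rw [elimTS_mulVec]
  exact q1_elimT_mulVec hL hLM _ hc

/-- Row sums of C_S are at most those of C, ≤ L^d. [folklore] -/
theorem elimTS_row (hL : 0 < L) (p : B4.Idx (pbox M) d) : ∑ k, |elimTS L M S hS p k| ≤ (L : ℝ) ^ d := by
  let ι : S ↪ freeT L M :=
    ⟨fun k => ⟨(k : B4.Idx (pbox M) d), hS k.2⟩, fun k k' h => by
      simp only [Subtype.mk.injEq] at h
      exact Subtype.ext h⟩
  calc ∑ k, |elimTS L M S hS p k| = ∑ f ∈ (Finset.univ : Finset S).map ι, |elimT L M p f| := by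
        rw [Finset.sum_map]
        rfl
    _ ≤ ∑ f, |elimT L M p f| := Finset.sum_le_univ_sum_of_nonneg fun f => abs_nonneg _
    _ ≤ (L : ℝ) ^ d := elimT_row hL p

variable (L M) in
/-- The SUB-FAMILY REDUCTION on the torus: variables = the torus bonds (the box), kept variables = S ⊆ remaining
variables, C = C_S; `.cov` = C_S(C_S*ΔC_S)⁻¹C_S* of (2.156). [cite: Balaban1984PropagatorsII, (2.156) p.250] -/
def subFamilyT (S : Finset (B4.Idx (pbox M) d)) (hS : S ⊆ freeT L M)
    (Δ : Matrix (B4.Idx (pbox M) d) (B4.Idx (pbox M) d) ℝ) : SubReduction d d :=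
  ⟨pbox M, S, Δ, elimTS L M S hS⟩

/-- Its covariance is literally (2.156) with C = C_S. [cite: Balaban1984PropagatorsII, (2.156) p.250] -/
theorem subFamilyT_cov (Δ : Matrix (B4.Idx (pbox M) d) (B4.Idx (pbox M) d) ℝ) :
    (subFamilyT L M S hS Δ).cov =
      elimTS L M S hS * ((elimTS L M S hS)ᵀ * Δ * elimTS L M S hS)⁻¹ * (elimTS L M S hS)ᵀ := rfl

/-- KERNEL-CHECKED: for EVERY sub-family S of the remaining torus variables, Δ symmetric with entry decay (c₀, δ₀) in
ρ_M and (2.153) with constant γ on the constrained subspace OF THE TORUS give the printed-shape inputs in ρ_M with the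
SAME constants as for the whole family (range L − 1, ℓ¹ sums ≤ L^d + 1): the first inequality of (2.157) for C_S is
(2.153)_T at B = C_S B′ = C(ext B′), which lies in the constrained subspace of the torus.
[cite: Balaban1984PropagatorsII, (2.153)–(2.157) pp.249–250] -/
theorem subFamilyT_printedPer [∀ μ, NeZero (M μ)] (hL : 0 < L) (hLM : ∀ i, L ∣ M i)
    {Δ : Matrix (B4.Idx (pbox M) d) (B4.Idx (pbox M) d) ℝ} {γ c₀ δ₀ : ℝ} (hs : Δ.IsSymm)
    (hd : ∀ p q : B4.Idx (pbox M) d,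
      |Δ p q| ≤ c₀ * Real.exp (-(δ₀ * pdist M (one_le_M M) (p.1 : Fin d → ℤ) (q.1 : Fin d → ℤ))))
    (hl : LowerOnConstrainedT L M Δ γ) :
    PrintedPer M (one_le_M M) (subFamilyT L M S hS Δ) γ c₀ δ₀ ((L : ℝ) - 1) ((L : ℝ) ^ d + 1) where
  symm := hs
  decay := hd
  lower w := hl _ (fun c hc => q1_elimTS_mulVec hS hL hLM w hc) (fun p hp => elimTS_mulVec_tree hS w hp)
  iso w := elimTS_iso hS w
  range p k h := elimT_range hL p ⟨k.1, hS k.2⟩ h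
  col k := (elimT_col hL hLM ⟨k.1, hS k.2⟩).trans (by
    have h1 : (1 : ℝ) ≤ (L : ℝ) ^ d := one_le_pow₀ (by exact_mod_cast hL)
    linarith)
  row p := (elimTS_row hS hL p).trans (by linarith)

variable (d) in
/-- KERNEL-CHECKED — the p. 250 sentence for EVERY SUB-FAMILY of the remaining torus variables, [3] DISCHARGED: ONE
(c, δ), chosen after (d, L, γ, c₀, δ₀) and before the torus, the operator and the sub-family, such that for every
torus (L ∣ M_i), every symmetric Δ with ρ_M-decay (c₀, δ₀) and (2.153)_T with constant γ, and every S ⊆ remaining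
variables: |C_S(C_S*ΔC_S)⁻¹C_S*(b,b′)| ≤ c·e^{−δρ_M(b₋,b′₋)}.  (`subFamilyT_printedPer` →
`B6BondEliminationTorus.subReductions_per`.) [cite: Balaban1984PropagatorsII, (2.152)–(2.157) pp.249–250] -/
theorem bond250_torusS (hL : 0 < L) {γ c₀ δ₀ : ℝ} (hγ : 0 < γ) (hc : 0 < c₀) (hδ : 0 < δ₀) :
    ∃ c δ : ℝ, 0 < c ∧ 0 < δ ∧
      ∀ (M : Fin d → ℕ) [∀ μ, NeZero (M μ)], (∀ i, L ∣ M i) →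
        ∀ Δ : Matrix (B4.Idx (pbox M) d) (B4.Idx (pbox M) d) ℝ, Δ.IsSymm →
        (∀ p q : B4.Idx (pbox M) d, |Δ p q| ≤
          c₀ * Real.exp (-(δ₀ * pdist M (one_le_M M) (p.1 : Fin d → ℤ) (q.1 : Fin d → ℤ)))) →
        LowerOnConstrainedT L M Δ γ →
        ∀ (S : Finset (B4.Idx (pbox M) d)) (hS : S ⊆ freeT L M),
        ∀ p q : B4.Idx (pbox M) d, |(subFamilyT L M S hS Δ).cov p q| ≤
          c * Real.exp (-(δ * pdist M (one_le_M M) (p.1 : Fin d → ℤ) (q.1 : Fin d → ℤ))) := by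
  have hm : (0 : ℝ) < (L : ℝ) ^ d + 1 := by positivity
  obtain ⟨c, δ, hc', hδ', H⟩ := subReductions_per d d (r := (L : ℝ) - 1) hγ hc hδ hm
  exact ⟨c, δ, hc', hδ', fun M _ hLM Δ hs hd hl S hS p q =>
    H M (one_le_M M) (subFamilyT L M S hS Δ) (box_separated M (one_le_M M))
      (subFamilyT_printedPer hS hL hLM hs hd hl) p q⟩

variable (d) in
/-- KERNEL-CHECKED — the same for the CONCRETE (1.66) form, (2.153)_T DISCHARGED: ONE (c, δ) (after d, L, c₀, δ₀)
such that for every torus (L ∣ M_i), every n ≥ 1, every symmetric Δ representing the (1.66) form at level n with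
ρ_M-decay (c₀, δ₀), and every sub-family S of the remaining variables: |C_S(C_S*ΔC_S)⁻¹C_S*(b,b′)| ≤
c·e^{−δρ_M(b₋,b′₋)}.  [cite: Balaban1984PropagatorsII, (2.152)–(2.157) pp.249–250; Balaban1984PropagatorsI,
(1.66)–(1.67) p.29] -/
theorem cov2156_torusS (hd : 2 ≤ d) (hL : 1 ≤ L) {c₀ δ₀ : ℝ} (hc : 0 < c₀) (hδ : 0 < δ₀) :
    ∃ c δ : ℝ, 0 < c ∧ 0 < δ ∧
      ∀ (M : Fin d → ℕ) [∀ μ, NeZero (M μ)], (∀ i, L ∣ M i) → ∀ n : ℕ, 1 ≤ n →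
        ∀ Δ : Matrix (B4.Idx (pbox M) d) (B4.Idx (pbox M) d) ℝ, Δ.IsSymm → Represents M n Δ →
        (∀ p q : B4.Idx (pbox M) d, |Δ p q| ≤
          c₀ * Real.exp (-(δ₀ * pdist M (one_le_M M) (p.1 : Fin d → ℤ) (q.1 : Fin d → ℤ)))) →
        ∀ (S : Finset (B4.Idx (pbox M) d)) (hS : S ⊆ freeT L M),
        ∀ p q : B4.Idx (pbox M) d, |(subFamilyT L M S hS Δ).cov p q| ≤
          c * Real.exp (-(δ * pdist M (one_le_M M) (p.1 : Fin d → ℤ) (q.1 : Fin d → ℤ))) := by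
  have hd1 : 1 ≤ d := by omega
  obtain ⟨c, δ, hc', hδ', H⟩ := bond250_torusS d (L := L) hL (gamma2153_pos hd1 hL) hc hδ
  exact ⟨c, δ, hc', hδ', fun M _ hLM n hn Δ hs hR hdec S hS p q =>
    H M hLM Δ hs hdec (lowerOnConstrainedT_of_represents M hd hL n hn hLM hR) S hS p q⟩

end SubFamily

/-! ## §2  Λ = B(Λ′₀) ⊂ T: the Λ-integral is the sub-family of Λ-bonds -/

section Lam

variable (L) (M) (Λ'₀ : Finset (Fin d → ℤ))

/-- **Λ-BONDS** (p. 245 *"We denote by Λ also a set of bonds b such that at least one of the end-points b₋, b₊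
belongs to Λ"*), on the torus: the bond ⟨z, z + e_ν⟩ of the box has z or z + e_ν in Λ = B(Λ′₀) modulo the periods
(`B6LowerBound2153Torus.InLam`). [cite: Balaban1984PropagatorsII, Lemma 2.4 p.245; dictionary] -/
def IsLam (p : B4.Idx (pbox M) d) : Prop :=
  InLam L M Λ'₀ (p.1 : Fin d → ℤ) ∨ InLam L M Λ'₀ ((p.1 : Fin d → ℤ) + unitVec p.2)

/-- `IsLam` is decidable (two `Finset` memberships). -/
instance isLam_decidable : DecidablePred (IsLam L M Λ'₀) := fun p => by
  unfold IsLam InLam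
  infer_instance

/-- THE REMAINING VARIABLES B′ OF THE Λ-INTEGRAL: the Λ-bonds among the remaining variables of the torus
(characterised in `mem_lamFree_iff`). [cite: Balaban1984PropagatorsII, p.249 *"If we denote the remaining variables
by B′"*; dictionary] -/
def lamFree : Finset (B4.Idx (pbox M) d) := (freeT L M).filter (IsLam L M Λ'₀)

/-- B′ of Λ ⊆ B′ of T. [folklore] -/
theorem lamFree_subset : lamFree L M Λ'₀ ⊆ freeT L M := Finset.filter_subset _ _

/-- THE ELIMINATION MATRIX OF THE Λ-INTEGRAL, B = C_ΛB′: the columns of the torus matrix C at the Λ-bonds.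
[cite: Balaban1984PropagatorsII, (2.154)–(2.156) pp.249–250] -/
abbrev elimLam : Matrix (B4.Idx (pbox M) d) (lamFree L M Λ'₀) ℝ :=
  elimTS L M (lamFree L M Λ'₀) (lamFree_subset L M Λ'₀)

/-- The instance of the reduction scheme for (2.152) ON Λ ⊂ T^{(k)}: kept variables = `lamFree`, C = C_Λ; `.cov` =
C_Λ(C_Λ*Δ_kC_Λ)⁻¹C_Λ* = C^{(k)}_Λ of (2.156) (padded with zero rows/columns outside Λ).
[cite: Balaban1984PropagatorsII, (2.156) p.250] -/
abbrev bondReductionLam (Δ : Matrix (B4.Idx (pbox M) d) (B4.Idx (pbox M) d) ℝ) : SubReduction d d :=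
  subFamilyT L M (lamFree L M Λ'₀) (lamFree_subset L M Λ'₀) Δ

variable {L M Λ'₀}

/-- Membership in the remaining variables of Λ. [folklore] -/
theorem mem_lamFree {p : B4.Idx (pbox M) d} : p ∈ lamFree L M Λ'₀ ↔ p ∈ freeT L M ∧ IsLam L M Λ'₀ p :=
  Finset.mem_filter

/-- Λ-membership through the representative. [folklore] -/
theorem inLam_wrap (hM0 : ∀ i, 0 < M i) (z : Fin d → ℤ) : InLam L M Λ'₀ (wrap M z) ↔ InLam L M Λ'₀ z := by
  unfold InLam
  rw [wrap_eq_self (wrap_mem_pbox hM0 z)]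

/-- Λ-membership of a translate through the representative. [folklore] -/
theorem inLam_wrap_add (z v : Fin d → ℤ) : InLam L M Λ'₀ (wrap M z + v) ↔ InLam L M Λ'₀ (z + v) := by
  unfold InLam
  rw [wrap_wrap_add]

/-- For a point of the box, membership in Λ mod M is membership of its corner in Λ′₀. [folklore] -/
theorem inLam_iff_corner {z : Fin d → ℤ} (hz : z ∈ pbox M) : InLam L M Λ'₀ z ↔ corner L z ∈ Λ'₀ := by
  unfold InLam
  rw [wrap_eq_self hz]

/-- Corners are L-lattice points. [folklore] -/
theorem corner_dvd (x : Fin d → ℤ) : ∀ i, (L : ℤ) ∣ corner L x i := fun i => ⟨x i / (L : ℤ), corner_apply x i⟩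

/-- b₀(c) + e_μ = c₊. [folklore] -/
theorem pivSite_add_unitVec (c : (Fin d → ℤ) × Fin d) : pivSite L c + unitVec c.2 = c.1 + (L : ℤ) • unitVec c.2 := by
  unfold pivSite
  rw [add_assoc, sub_smul, one_smul, sub_add_cancel]

/-- The pivot site of a face is in Λ mod M iff the face's lower corner is. [folklore] -/
theorem inLam_pivSite (hL : 0 < L) (hM0 : ∀ i, 0 < M i) (hLM : ∀ i, L ∣ M i) {c : (Fin d → ℤ) × Fin d}
    (hc : c ∈ faces L M) : InLam L M Λ'₀ (pivSite L c) ↔ InLam L M Λ'₀ c.1 :=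
  inLam_iff_of_mem_block M hL hM0 hLM (coarseSites_dvd _ (mem_faces.1 hc)) (pivSite_mem_block hL c)

/-- KERNEL-CHECKED: **the pivot b₀(c) of a face c of the torus is a Λ-bond iff c meets Λ′₀** (c₋ or c₊ in Λ′₀ mod
M) — so the constraints δ((QB)(c)) of the Λ-integral, *"c ∈ Λ′"*, are exactly those whose pivots are Λ-bonds.
[cite: Balaban1984PropagatorsII, p.249 *"b₀ is a bond belonging to B(c) for some c ∈ Λ′, and contained in c"*;
dictionary] -/
theorem isLam_iff_of_cOf_mem (hL : 0 < L) (hM0 : ∀ i, 0 < M i) (hLM : ∀ i, L ∣ M i) {p : B4.Idx (pbox M) d}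
    (hK : cOf L (p.1 : Fin d → ℤ) p.2 ∈ faces L M) :
    IsLam L M Λ'₀ p ↔ cOf L (p.1 : Fin d → ℤ) p.2 ∈ facesOf L M Λ'₀ := by
  set c := cOf L (p.1 : Fin d → ℤ) p.2 with hcdef
  have e1 : (p.1 : Fin d → ℤ) = pivSite L c := (pivSite_cOf _ _).symm
  have e2 : p.2 = c.2 := rfl
  have h1 : InLam L M Λ'₀ (p.1 : Fin d → ℤ) ↔ InLam L M Λ'₀ c.1 := by
    rw [e1]
    exact inLam_pivSite hL hM0 hLM hK
  have h2 : InLam L M Λ'₀ ((p.1 : Fin d → ℤ) + unitVec p.2) ↔ InLam L M Λ'₀ (c.1 + (L : ℤ) • unitVec c.2) := by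
    rw [e1, e2, pivSite_add_unitVec]
  rw [mem_facesOf, IsLam, h1, h2]
  exact ⟨fun h => ⟨hK, h⟩, fun h => h.2⟩

/-- KERNEL-CHECKED: **a torus average (Q₁B)(c) of a coarse bond c NOT meeting Λ′₀ involves no Λ-bond** — every unit
bond of its straight contours [x, x + Le_μ], x ∈ B(c₋), has both end-points in B(c₋) ∪ B(c₊), outside Λ (gen 5's
`not_inLam_segment`, through the wrapping). [cite: Balaban1984PropagatorsII, (2.125) p.245; dictionary] -/
theorem multP_eq_zero_of_not_meeting (hL : 0 < L) (hM0 : ∀ i, 0 < M i) (hLM : ∀ i, L ∣ M i)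
    {c : (Fin d → ℤ) × Fin d} (hc : c ∈ faces L M) (hc' : c ∉ facesOf L M Λ'₀) {k : B4.Idx (pbox M) d}
    (hk : IsLam L M Λ'₀ k) : multP L M c (k.1 : Fin d → ℤ) k.2 = 0 := by
  by_contra h
  obtain ⟨hν, z', hz', hm⟩ := exists_of_multP_ne_zero h
  unfold mult at hm
  rw [if_pos rfl] at hm
  obtain ⟨xs, hxs⟩ := Finset.card_ne_zero.1 hm
  obtain ⟨⟨hx, hsL⟩, hz'eq⟩ := mem_hits.1 hxs
  have h1 : ¬ InLam L M Λ'₀ c.1 := fun h' => hc' ((mem_facesOf M).2 ⟨hc, Or.inl h'⟩)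
  have h2 : ¬ InLam L M Λ'₀ (c.1 + (L : ℤ) • unitVec c.2) := fun h' => hc' ((mem_facesOf M).2 ⟨hc, Or.inr h'⟩)
  have hyd : ∀ i, (L : ℤ) ∣ c.1 i := coarseSites_dvd _ (mem_faces.1 hc)
  have hsL' : (xs.2 : ℤ) < (L : ℤ) := by exact_mod_cast hsL
  rcases hk with hk | hk
  · rw [← hz', inLam_wrap hM0, ← hz'eq] at hk
    exact not_inLam_segment M hL hM0 hLM hyd hx h1 h2 (by positivity) hsL'.le hk
  · rw [← hz', inLam_wrap_add, ← hz'eq, hν, add_assoc] at hk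
    have e : (xs.2 : ℤ) • unitVec c.2 + unitVec c.2 = ((xs.2 : ℤ) + 1) • unitVec c.2 := by
      rw [add_smul, one_smul]
    rw [e] at hk
    exact not_inLam_segment M hL hM0 hLM hyd hx h1 h2 (by positivity) (by omega) hk

/-- KERNEL-CHECKED, p. 250 *"CB′ = 0 outside Λ"* at the level of entries: **the rows of the torus matrix C outside
Λ vanish on the columns of the Λ-bonds** (a non-Λ bond is never a remaining Λ-variable; if it is a pivot b₀(c) then c
does not meet Λ′₀ and (Q₁B)(c) involves no Λ-bond). [cite: Balaban1984PropagatorsII, p.250] -/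
theorem elimT_eq_zero_of_not_isLam (hL : 0 < L) (hM0 : ∀ i, 0 < M i) (hLM : ∀ i, L ∣ M i)
    {p : B4.Idx (pbox M) d} (hp : ¬ IsLam L M Λ'₀ p) {k : B4.Idx (pbox M) d} (hkF : k ∈ freeT L M)
    (hk : IsLam L M Λ'₀ k) : elimT L M p ⟨k, hkF⟩ = 0 := by
  rw [elimT_apply]
  split_ifs with h1 h2
  · exact absurd (h1 ▸ hk) hp
  · rfl
  · have hK : cOf L (p.1 : Fin d → ℤ) p.2 ∈ faces L M := by
      by_contra hK
      exact h2 (Or.inr hK)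
    have hK' : cOf L (p.1 : Fin d → ℤ) p.2 ∉ facesOf L M Λ'₀ := fun h =>
      hp ((isLam_iff_of_cOf_mem hL hM0 hLM hK).2 h)
    have h0 := multP_eq_zero_of_not_meeting hL hM0 hLM hK hK' hk
    simp only [h0, Nat.cast_zero, zero_div, neg_zero]

/-- KERNEL-CHECKED, p. 250 *"By the definition of C we have of course that CB′ = 0 outside Λ … for arbitrary B′"*:
C_ΛB′ vanishes on every bond of the torus with no end-point in Λ. [cite: Balaban1984PropagatorsII, p.250] -/
theorem elimLam_mulVec_eq_zero [∀ μ, NeZero (M μ)] (hL : 0 < L) (hLM : ∀ i, L ∣ M i) (w : lamFree L M Λ'₀ → ℝ)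
    {p : B4.Idx (pbox M) d} (hp : ¬ IsLam L M Λ'₀ p) : (elimLam L M Λ'₀ *ᵥ w) p = 0 := by
  refine Finset.sum_eq_zero fun k _ => ?_
  have hk := mem_lamFree.1 k.2
  have h0 : elimLam L M Λ'₀ p k = 0 := elimT_eq_zero_of_not_isLam hL (pos_of_neZero M) hLM hp hk.1 hk.2
  dsimp only
  rw [h0, zero_mul]

/-- For a tree bond b = ⟨z, z + e_ν⟩ of a block of the torus, z + e_ν lies in the same block B(corner z).
[folklore] -/
theorem succ_mem_block_of_isTree (hL : 0 < L) {p : B4.Idx (pbox M) d} (h : IsTree L (coarseSites L M) p) :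
    (p.1 : Fin d → ℤ) + unitVec p.2 ∈ B6Elimination.block L (corner L (p.1 : Fin d → ℤ)) := by
  obtain ⟨-, h2, -⟩ := h
  refine mem_block.2 fun i => ?_
  have hb := mem_block.1 (mem_block_corner hL (p.1 : Fin d → ℤ)) i
  rw [Pi.add_apply, unitVec_apply]
  by_cases hi : i = p.2
  · subst hi
    simp only [if_true]
    exact ⟨by omega, by omega⟩
  · simp only [if_neg hi, add_zero]
    exact hb

/-- A tree bond of a block of the torus is a Λ-bond iff its block is a block of Λ′₀. [folklore] -/
theorem isLam_iff_of_isTree (hL : 0 < L) (hM0 : ∀ i, 0 < M i) (hLM : ∀ i, L ∣ M i) {p : B4.Idx (pbox M) d}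
    (h : IsTree L (coarseSites L M) p) : IsLam L M Λ'₀ p ↔ corner L (p.1 : Fin d → ℤ) ∈ Λ'₀ := by
  have hc : InLam L M Λ'₀ (corner L (p.1 : Fin d → ℤ)) ↔ corner L (p.1 : Fin d → ℤ) ∈ Λ'₀ :=
    inLam_iff_mem M (corner_mem_coarseSites hL p.1.2)
  have h1 : InLam L M Λ'₀ (p.1 : Fin d → ℤ) ↔ corner L (p.1 : Fin d → ℤ) ∈ Λ'₀ := inLam_iff_corner p.1.2
  have h2 : InLam L M Λ'₀ ((p.1 : Fin d → ℤ) + unitVec p.2) ↔ corner L (p.1 : Fin d → ℤ) ∈ Λ'₀ := by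
    rw [← hc]
    exact inLam_iff_of_mem_block M hL hM0 hLM (corner_dvd _) (succ_mem_block_of_isTree hL h)
  unfold IsLam
  rw [h1, h2, or_self]

/-- KERNEL-CHECKED — **THE REMAINING VARIABLES OF THE Λ-INTEGRAL** (p. 249: remove *"the variables B_b for
b ⊂ Γ_{y,x}"*, y ∈ Λ′, and *"the variables B_{b₀}, where b₀ is a bond belonging to B(c) for some c ∈ Λ′"*; the rest
of B↾Λ is B′): a torus bond is in `lamFree` iff it is a Λ-bond, not the pivot b₀(c) of a coarse bond c meeting Λ′₀,
and not a tree bond of a block B(y), y ∈ Λ′₀ (∩ T′). [cite: Balaban1984PropagatorsII, p.249] -/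
theorem mem_lamFree_iff (hL : 0 < L) (hM0 : ∀ i, 0 < M i) (hLM : ∀ i, L ∣ M i) {k : B4.Idx (pbox M) d} :
    k ∈ lamFree L M Λ'₀ ↔ IsLam L M Λ'₀ k ∧ cOf L (k.1 : Fin d → ℤ) k.2 ∉ facesOf L M Λ'₀ ∧
      ¬ IsTree L (coarseSites L M ∩ Λ'₀) k := by
  rw [mem_lamFree, mem_freeB]
  constructor
  · rintro ⟨⟨hK, hT⟩, hk⟩
    refine ⟨hk, fun h => hK ((mem_facesOf M).1 h).1, fun h => hT ?_⟩
    exact ⟨(Finset.mem_inter.1 h.1).1, h.2⟩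
  · rintro ⟨hk, hK, hT⟩
    refine ⟨⟨fun h => hK ((isLam_iff_of_cOf_mem hL hM0 hLM h).1 hk), fun h => hT ?_⟩, hk⟩
    exact ⟨Finset.mem_inter.2 ⟨h.1, (isLam_iff_of_isTree hL hM0 hLM h).1 hk⟩, h.2⟩

/-- KERNEL-CHECKED, p. 250 *"QCB′ = 0"* for the Λ-integral: (Q₁(C_ΛB′)^per)(c) = 0 at EVERY coarse bond of the torus
(in particular at those meeting Λ′₀). [cite: Balaban1984PropagatorsII, p.250] -/
theorem q1_elimLam_mulVec [∀ μ, NeZero (M μ)] (hL : 0 < L) (hLM : ∀ i, L ∣ M i) (w : lamFree L M Λ'₀ → ℝ)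
    {c : (Fin d → ℤ) × Fin d} (hc : c ∈ faces L M) : q1 L (perExt M (elimLam L M Λ'₀ *ᵥ w)) c = 0 :=
  q1_elimTS_mulVec (lamFree_subset L M Λ'₀) hL hLM w hc

/-- KERNEL-CHECKED, p. 250 *"(CB′)(Γ_{y,x}) = 0, x ∈ B(y), y ∈ Λ′, for arbitrary B′"* for the Λ-integral: C_ΛB′
vanishes on the tree bonds of EVERY block of the torus (in particular of those of Λ′₀).
[cite: Balaban1984PropagatorsII, p.250] -/
theorem elimLam_mulVec_tree (w : lamFree L M Λ'₀ → ℝ) {p : B4.Idx (pbox M) d}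
    (hp : IsTree L (coarseSites L M) p) : (elimLam L M Λ'₀ *ᵥ w) p = 0 :=
  elimTS_mulVec_tree (lamFree_subset L M Λ'₀) w hp

/-- KERNEL-CHECKED (C_Λ PARAMETRIZES THE CONSTRAINED SUBSPACE OF THE Λ-INTEGRAL — the change of variables
(2.154) = (2.155) for Λ): for B on the torus bonds with B = 0 outside Λ, (Q₁B^per)(c) = 0 at the coarse bonds c
meeting Λ′₀ and B(Γ_{y,x}) = 0 on the blocks B(y), y ∈ Λ′₀, C_Λ(B↾remaining Λ-variables) = B.  (The other torus
constraints hold automatically: gen 5's `q1_eq_zero_of_not_meeting`, and the tree bonds of the other blocks are not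
Λ-bonds; then `B6Cov2156Torus.elimT_restrT`.) [cite: Balaban1984PropagatorsII, (2.154)–(2.155) pp.249–250] -/
theorem elimLam_restr [∀ μ, NeZero (M μ)] (hL : 0 < L) (hLM : ∀ i, L ∣ M i) {B : B4.Idx (pbox M) d → ℝ}
    (hsupp : ∀ p, ¬ IsLam L M Λ'₀ p → B p = 0)
    (hQ : ∀ c ∈ facesOf L M Λ'₀, q1 L (perExt M B) c = 0)
    (hT : ∀ p, IsTree L (coarseSites L M ∩ Λ'₀) p → B p = 0) :
    elimLam L M Λ'₀ *ᵥ (fun k => B k) = B := by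
  have hM0 := pos_of_neZero M
  have hsupp' : ∀ (x : Fin d → ℤ) (ν : Fin d), ¬ InLam L M Λ'₀ x → ¬ InLam L M Λ'₀ (x + unitVec ν) →
      perExt M B (x, ν) = 0 := by
    intro x ν h1 h2
    refine hsupp _ ?_
    rintro (h | h)
    · exact h1 ((inLam_wrap hM0 x).1 h)
    · exact h2 ((inLam_wrap_add x _).1 h)
  have hQ' : ∀ c ∈ faces L M, q1 L (perExt M B) c = 0 := by
    intro c hc
    by_cases hc' : c ∈ facesOf L M Λ'₀
    · exact hQ c hc'
    · have h1 : ¬ InLam L M Λ'₀ c.1 := fun h' => hc' ((mem_facesOf M).2 ⟨hc, Or.inl h'⟩)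
      have h2 : ¬ InLam L M Λ'₀ (c.1 + (L : ℤ) • unitVec c.2) := fun h' => hc' ((mem_facesOf M).2 ⟨hc, Or.inr h'⟩)
      exact q1_eq_zero_of_not_meeting M hL hM0 hLM hsupp' hc h1 h2
  have hT' : ∀ p, IsTree L (coarseSites L M) p → B p = 0 := by
    intro p hp
    by_cases hy : corner L (p.1 : Fin d → ℤ) ∈ Λ'₀
    · exact hT p ⟨Finset.mem_inter.2 ⟨hp.1, hy⟩, hp.2⟩
    · exact hsupp p fun h => hy ((isLam_iff_of_isTree hL hM0 hLM hp).1 h)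
  have key := elimT_restrT hL hLM hQ' hT'
  have hext : extS L M (lamFree L M Λ'₀) (fun k => B k) = restrT B := by
    funext f
    by_cases hf : (f : B4.Idx (pbox M) d) ∈ lamFree L M Λ'₀
    · have h := extS_apply_mem (lamFree_subset L M Λ'₀) (fun k : lamFree L M Λ'₀ => B k) ⟨f, hf⟩
      exact h
    · rw [extS_apply_of_not_mem _ f hf]
      exact (hsupp _ fun h => hf (mem_lamFree.2 ⟨f.2, h⟩)).symm
  rw [elimTS_mulVec, hext, key]

/-- KERNEL-CHECKED: **C_Λ*ΔC_Λ sees only the entries Δ(b, b′) with b, b′ Λ-bonds** — the exponent of the Λ-integral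
is ⟨B, Δ_kB⟩ for B = C_ΛB′ = 0 outside Λ. [cite: Balaban1984PropagatorsII, (2.154)–(2.156) pp.249–250] -/
theorem sandwich_eq_of_agree [∀ μ, NeZero (M μ)] (hL : 0 < L) (hLM : ∀ i, L ∣ M i)
    {Δ Δ' : Matrix (B4.Idx (pbox M) d) (B4.Idx (pbox M) d) ℝ}
    (h : ∀ p q, IsLam L M Λ'₀ p → IsLam L M Λ'₀ q → Δ p q = Δ' p q) :
    (elimLam L M Λ'₀)ᵀ * Δ * elimLam L M Λ'₀ = (elimLam L M Λ'₀)ᵀ * Δ' * elimLam L M Λ'₀ := by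
  have hz : ∀ {p : B4.Idx (pbox M) d} (k : lamFree L M Λ'₀), ¬ IsLam L M Λ'₀ p → elimLam L M Λ'₀ p k = 0 :=
    fun k hp => elimT_eq_zero_of_not_isLam hL (pos_of_neZero M) hLM hp (mem_lamFree.1 k.2).1 (mem_lamFree.1 k.2).2
  ext k k'
  simp only [Matrix.mul_apply, Matrix.transpose_apply]
  refine Finset.sum_congr rfl fun q _ => ?_
  by_cases hq : IsLam L M Λ'₀ q
  · congr 1
    refine Finset.sum_congr rfl fun p _ => ?_
    by_cases hp : IsLam L M Λ'₀ p
    · rw [h p q hp hq]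
    · rw [hz k hp, zero_mul, zero_mul]
  · rw [hz k' hq, mul_zero, mul_zero]

/-- KERNEL-CHECKED: hence **C^{(k)}_Λ depends on Δ_k only through its Λ × Λ entries**.
[cite: Balaban1984PropagatorsII, (2.156) p.250] -/
theorem cov_eq_of_agree [∀ μ, NeZero (M μ)] (hL : 0 < L) (hLM : ∀ i, L ∣ M i)
    {Δ Δ' : Matrix (B4.Idx (pbox M) d) (B4.Idx (pbox M) d) ℝ}
    (h : ∀ p q, IsLam L M Λ'₀ p → IsLam L M Λ'₀ q → Δ p q = Δ' p q) :
    (bondReductionLam L M Λ'₀ Δ).cov = (bondReductionLam L M Λ'₀ Δ').cov := by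
  rw [subFamilyT_cov, subFamilyT_cov, sandwich_eq_of_agree hL hLM h]

/-- **Consistency with the whole torus**: for Λ′₀ ⊇ T′ every torus bond is a Λ-bond and the remaining variables of Λ
are those of T. [folklore] -/
theorem lamFree_univ [∀ μ, NeZero (M μ)] (hL : 0 < L) (hΛ : coarseSites L M ⊆ Λ'₀) : lamFree L M Λ'₀ = freeT L M := by
  refine Finset.filter_true_of_mem fun p _ => Or.inl ?_
  rw [inLam_iff_corner p.1.2]
  exact hΛ (corner_mem_coarseSites hL p.1.2)

end Lam

/-! ## §3  (2.152)–(2.157) on Λ ⊂ T^(k), END-TO-END -/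

section EndToEnd

variable (d) in
/-- **KERNEL-CHECKED — B6 (2.152)–(2.157) ON A SUBSET Λ ⊂ T^{(k)}, END-TO-END FOR THE CONCRETE (1.66) FORM, modulo
the decay of Δ_k.**  Let d ≥ 2, L ≥ 1, c₀, δ₀ > 0.  There are c, δ > 0 (depending on d, L, c₀, δ₀ only — the
constants of the whole-torus theorem) such that for EVERY torus T^{(k)} (L ∣ M_i), EVERY n ≥ 1, EVERY symmetric Δ
on the torus bond variables representing the (1.66) form at level n with |Δ(b,b′)| ≤ c₀e^{−δ₀ρ_M(b₋,b′₋)}, and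
EVERY Λ = B(Λ′₀) ⊂ T^{(k)}: the covariance C^{(k)}_Λ = C_Λ(C_Λ*Δ_kC_Λ)⁻¹C_Λ* of (2.156) of the Λ-integral
(2.152)/(2.154) — variables B↾Λ (Λ-bonds), B = 0 outside Λ, δ((QB)(c)) with the torus average for the coarse bonds
meeting Λ′₀, δ_{Ax} on the blocks of Λ′₀, the explicit C_Λ — satisfies |C^{(k)}_Λ(b,b′)| ≤ c·e^{−δρ_M(b₋,b′₋)}.
[cite: Balaban1984PropagatorsII, (2.152)–(2.157) pp.249–250 *"or on a subset Λ ⊂ T^{(k)}"*, *"hence for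
C^{(k)}_Λ also"*; Balaban1984PropagatorsI, (1.66)–(1.67) p.29] -/
theorem cov2156_torus_subset (hd : 2 ≤ d) (hL : 1 ≤ L) {c₀ δ₀ : ℝ} (hc : 0 < c₀) (hδ : 0 < δ₀) :
    ∃ c δ : ℝ, 0 < c ∧ 0 < δ ∧
      ∀ (M : Fin d → ℕ) [∀ μ, NeZero (M μ)], (∀ i, L ∣ M i) → ∀ n : ℕ, 1 ≤ n →
        ∀ Δ : Matrix (B4.Idx (pbox M) d) (B4.Idx (pbox M) d) ℝ, Δ.IsSymm → Represents M n Δ →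
        (∀ p q : B4.Idx (pbox M) d, |Δ p q| ≤
          c₀ * Real.exp (-(δ₀ * pdist M (one_le_M M) (p.1 : Fin d → ℤ) (q.1 : Fin d → ℤ)))) →
        ∀ (Λ'₀ : Finset (Fin d → ℤ)) (p q : B4.Idx (pbox M) d), |(bondReductionLam L M Λ'₀ Δ).cov p q| ≤
          c * Real.exp (-(δ * pdist M (one_le_M M) (p.1 : Fin d → ℤ) (q.1 : Fin d → ℤ))) := by
  obtain ⟨c, δ, hc', hδ', H⟩ := cov2156_torusS d (L := L) hd hL hc hδ
  exact ⟨c, δ, hc', hδ', fun M _ hLM n hn Δ hs hR hdec Λ'₀ p q =>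
    H M hLM n hn Δ hs hR hdec (lamFree L M Λ'₀) (lamFree_subset L M Λ'₀) p q⟩

variable (d) in
/-- **KERNEL-CHECKED — THE SAME FOR THE MATRIX OF THE (1.66) FORM, the decay of its kernel the ONLY hypothesis**:
d ≥ 2, L ≥ 1, c₀, δ₀ > 0 ⟹ ∃ c, δ > 0 ∀ tori M (L ∣ M_i) ∀ n ≥ 1, `KernelDecay M n c₀ δ₀` →
∀ Λ = B(Λ′₀) ⊂ T^{(k)} ∀ b, b′: |C^{(k)}_Λ(b,b′)| ≤ c·e^{−δρ_M(b₋,b′₋)} for C^{(k)}_Λ built on `deltaPol M n`.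
[cite: Balaban1984PropagatorsII, (2.152)–(2.157) pp.249–250; Balaban1984PropagatorsI, (1.66) p.29] -/
theorem cov2156_torus_subset_deltaPol (hd : 2 ≤ d) (hL : 1 ≤ L) {c₀ δ₀ : ℝ} (hc : 0 < c₀) (hδ : 0 < δ₀) :
    ∃ c δ : ℝ, 0 < c ∧ 0 < δ ∧
      ∀ (M : Fin d → ℕ) [∀ μ, NeZero (M μ)], (∀ i, L ∣ M i) → ∀ n : ℕ, 1 ≤ n → KernelDecay M n c₀ δ₀ →
        ∀ (Λ'₀ : Finset (Fin d → ℤ)) (p q : B4.Idx (pbox M) d),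
          |(bondReductionLam L M Λ'₀ (deltaPol M n)).cov p q| ≤
            c * Real.exp (-(δ * pdist M (one_le_M M) (p.1 : Fin d → ℤ) (q.1 : Fin d → ℤ))) := by
  obtain ⟨c, δ, hc', hδ', H⟩ := cov2156_torus_subset d (L := L) hd hL hc hδ
  exact ⟨c, δ, hc', hδ', fun M _ hLM n hn hK Λ'₀ p q =>
    H M hLM n hn (deltaPol M n) (deltaPol_isSymm M n) (represents_deltaPol M n) hK Λ'₀ p q⟩

end EndToEnd

end

end Literature.MathematicalPhysics.QuantumFieldTheory.Balaban1983to89.B6Cov2156TorusSubset
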